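import Literature.MathematicalPhysics.QuantumFieldTheory.Balaban1983to89.B9GeoNormsKLevelV1
import Literature.MathematicalPhysics.QuantumFieldTheory.Balaban1983to89.B11Eq115Space
import HarnessLib

/-!
# Route `UnitScaleTilt`, crux K1 «MinimiserStabilityRegPr» (stmt-QuantumFields-19200), v10 stub `stub_existenceMinimalOrbit`, route (α), node N06(d = 3) —
# THE ONE d-GENERIC IDENTIFICATION `Space115 ∕ NegSize` (Sect. E of [Balaban1985Variational], the (115) normed carriers of `B11Eq115Space`) ↔ THE LEVEL-WEIGHTED
# SUP FAMILY `|·|_{(γ)}` OF [Balaban1985BackgroundPropagators] (3.41)∕(3.47) (`B8ScaledSupNorm.msup`, read on the k-level torus index as `B9GeoNormsKLevelV1.wNormB ∕ wNormS` =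
# the `wNorm` letter of the geometry reading `geo9K` in `B9.Thm313Printed`'s global clause)

Cell `ym3-torus`, width seat `ym-ust-20520-w2` (g2), OWNER RULING g25-№2 §3 (2026-08-28): «so that (S3-b) can read `Thm313Printed`'s global clause (3.47)₁ AS `SectEDatum.norm_G`».
THEOREMS ONLY (0 `def`, 0 `sorry`); nothing of [B9]∕[B11]'s estimates is asserted; YM₃ on T³ is a ladder rung (R3), not the Clay problem; nothing here is about the gap.

THE TWO VOCABULARIES.  (i) `B11Eq115Space`: `NegSize L η lev n V` = functions `ι → V` normed by `sup_x (L^{lev x}·η)^n·‖f x‖` (print's `|·|_{(−n)}`, p. 286), and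
`Space115 L η lev₀ lev₁ ∇` = the jet norm `max{|A|_{(−1)}, |∇A|_{(−2)}}` ((115) p. 294) — the carriers of `B11Prop6Concrete.SectEDatum.norm_G ∕ norm_H₁ ∕ prop4`.
(ii) `B8ScaledSupNorm.msup L k η α mem F = sup_{j ≤ k} sup_{mem j x} (Lʲη)^{−α}·‖F x‖` = [B9] (3.41) `|F|_{(α)}` («the smallest number C such that |A(b)| ≤ C(Lʲη)^α for
b ∈ Ω_j∖Ω_{j+1}»), read on the V1 k-level torus member `i : KIdx d ℓ …` as `wNormB i γ` (fine-bond functions, membership «the block of the bond has level j») and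
`wNormS i γ` (torus-site functions) — the `wNorm` field of `geo9K i`, i.e. the right-hand side `B₀·g.wNorm γ λ` of `B9.Ineq342_346_347(_noLap)`'s global clause.

WHAT IS PROVED (ns `…Theorems.Prop7SectE115WNormDict`).
* §1 `msup_norm_comp` (`msup … (fun x ↦ ‖f x‖) = msup … f`: the ℝ-valued profile has the same weighted sup) and ★ `msup_levelEq_eq_norm_negSize` — THE IDENTITY: for a level
  map `lev : ι → ℕ` bounded by `k` and the EXACT-level membership `mem j x :↔ lev x = j`, `msup L k η (−n) mem f = ‖f‖_{NegSize L η lev n}` (both sides are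
  `sup_x (L^{lev x}η)^n‖f x‖`; `B8ScaledSupNorm.weight_neg_natCast`); constants `1` in BOTH directions, for EVERY level profile — not only on the diagonal.
* §2 the jet norm: `norm_space115_eq_max_msup` (`‖A‖_{(115)} = max (|A|_{(−1)}) (|∇A|_{(−2)})` in `msup` letters) and ★ `forall_norm_le_iff_msup_pair` — the SHAPE
  DICTIONARY: for ANY map `G : NegSize L η lev₀ 3 V → Space115 L η lev₀ lev₁ ∇` and constant `B₀`, `(∀ λ, ‖G λ‖ ≤ B₀‖λ‖)` (= `SectEDatum.norm_G`'s text) ↔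
  `(∀ λ, |Gλ|_{(−1)} ≤ B₀|λ|_{(−3)} ∧ |∇(Gλ)|_{(−2)} ≤ B₀|λ|_{(−3)})` (= (3.47) `|G′λ|_{(2+γ)}, |∇_U G′λ|_{(1+γ)} ≤ B₀|λ|_{(γ)}` at `γ = −3`, in `msup` letters).
* §3 on the V1 index: `wNormB_norm_comp`, ★ `wNormB_neg_natCast_eq_norm_negSize` ∕ `wNormS_neg_natCast_eq_norm_negSize` — `wNormB i (−n) J = ‖J‖_{NegSize (ℓ+1) |c_f|⁻¹ (level
  of the bond's block) n}` verbatim (`blkV1_level_le`), so `geo9K`'s `wNorm` at `γ = −n` on either summand of `KLoc` IS a (115)-size.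
* §4 the pure-small-field DIAGONAL (every `Ω_j` the torus, one level `lev ≡ k`, `Lᵏη = 1` — ★w5-20520's transport item (t3)): `levWeight_eq_one_of_diag`,
  ★ `norm_negSize_eq_norm_of_diag` (`‖f‖_{(−n)} = ‖f‖_∞`), `msup_eq_norm_of_diag`.
HONEST SCOPE.  Real-analysis bookkeeping (two sups of the same finite family); no estimate; the consumer (★w4-19200 g0's (S3-b) knit `normG_normH₁_of_N06d3Obligations`)
still owes the DEFINITION of the T³ `KernelFamily`'s `glob` entries as these weighted sups of `𝔊λ`, `∇_U𝔊λ` — this file only guarantees that, once so defined, (3.47)₁ at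
`γ = −3` and `SectEDatum.norm_G` are the same sentence.  `--supports stmt-QuantumFields-19200`, count-neutral.

References: T. Bałaban, CMP 102 (1985) 277–309 [Balaban1985Variational] (p.286 (the sizes |·|_{(−n)}), (98) p.293, (115) p.294, (117) p.295); CMP 99 (1985) 389–434
[Balaban1985BackgroundPropagators] ((3.39)–(3.41) p.397, (3.47) p.398, Thm 3.13 p.426); CMP 99 (1985) 75–102 [Balaban1985RegularSpaces] (p.86, the norm |·|_{(α)}).
-/

set_option autoImplicit false

noncomputable section

namespace Summit.QuantumFields.YangMills.Theorems.Prop7SectE115WNormDict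

open Literature.MathematicalPhysics.QuantumFieldTheory.Balaban1983to89
open Literature.MathematicalPhysics.QuantumFieldTheory.Balaban1983to89.B8ScaledSupNorm
  (weight msup Bdd weight_neg_natCast weight_mul_norm_le_msup msup_le msup_nonneg)
open Literature.MathematicalPhysics.QuantumFieldTheory.Balaban1983to89.B11Eq115Space
open Literature.MathematicalPhysics.QuantumFieldTheory.Balaban1983to89.B9GeoNormsKLevelV1 (wNormB wNormS blkV1_level_le blkOf_level_le)
open B6GlobalChartV1 (PV blkV1)
open B6Geom246MultiLevelBox (blkOf)
open B6KLevelCensusIndexV1 (KIdx)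
open Node00 (toKT)

/-! ## §1 The identity: `msup` at `α = −n` with exact-level membership IS the `NegSize` norm -/

section Core

variable {ι : Type*} [Fintype ι] {E : Type*} [NormedAddCommGroup E]

omit [Fintype ι] in
/-- The weighted sup of the ℝ-valued profile `x ↦ ‖f x‖` is the weighted sup of `f` (`‖(‖f x‖ : ℝ)‖ = ‖f x‖`). [folklore] -/
theorem msup_norm_comp (L k : ℕ) (η α : ℝ) (mem : ℕ → ι → Prop) (f : ι → E) :
    msup L k η α mem (fun x => ‖f x‖) = msup L k η α mem f := by
  unfold msup
  simp only [norm_norm]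

/-- ★ **THE IDENTIFICATION `|·|_{(−n)}` ([B9] (3.41) ∕ [B8] p.86, `msup`) = `‖·‖_{NegSize}` ((115)'s carrier)**: for a level map `lev : ι → ℕ` with `lev x ≤ k` everywhere
and the exact-level membership `mem j x :↔ lev x = j`, `msup L k η (−n) mem f = ‖f‖_{NegSize L η lev n}` — both are `sup_x (L^{lev x}η)^n·‖f x‖` (`0 < L`, `0 < η`).
Constant `1` in both directions, for every level profile. [cite: Balaban1985BackgroundPropagators, (3.41) p.397; Balaban1985Variational, p.286] -/
theorem msup_levelEq_eq_norm_negSize {L : ℕ} {η : ℝ} [hL : Fact (0 < ((L : ℕ) : ℝ))] [hη : Fact (0 < η)]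
    {k : ℕ} {lev : ι → ℕ} (hlev : ∀ x, lev x ≤ k) (n : ℕ) (f : ι → E) :
    msup L k η (-(n : ℝ)) (fun j x => lev x = j) f = ‖(NegSup.equiv (levWeight (L : ℝ) η lev n) E).symm f‖ := by
  -- every weighted value is one of the `NegSize` profile values, and conversely
  have hval : ∀ x, weight L η (-(n : ℝ)) (lev x) * ‖f x‖ = levWeight (L : ℝ) η lev n x * ‖f x‖ := fun x => by
    rw [weight_neg_natCast, levWeight_apply]
  have h1 : msup L k η (-(n : ℝ)) (fun j x => lev x = j) f ≤ ‖(NegSup.equiv (levWeight (L : ℝ) η lev n) E).symm f‖ := by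
    refine msup_le (norm_nonneg _) fun j _ x hx => ?_
    subst hx
    rw [hval x]
    simpa using NegSup.weight_mul_norm_apply_le ((NegSup.equiv (levWeight (L : ℝ) η lev n) E).symm f) x
  have hB : Bdd L k η (-(n : ℝ)) (fun j x => lev x = j) f :=
    ⟨‖(NegSup.equiv (levWeight (L : ℝ) η lev n) E).symm f‖, fun j _ x hx => by
      subst hx
      rw [hval x]
      simpa using NegSup.weight_mul_norm_apply_le ((NegSup.equiv (levWeight (L : ℝ) η lev n) E).symm f) x⟩
  have h2 : ‖(NegSup.equiv (levWeight (L : ℝ) η lev n) E).symm f‖ ≤ msup L k η (-(n : ℝ)) (fun j x => lev x = j) f := by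
    refine NegSup.norm_symm_le_of_pointwise (msup_nonneg L k hη.out.le _ _ _) fun x => ?_
    rw [← hval x]
    exact weight_mul_norm_le_msup hB (hlev x) rfl
  exact le_antisymm h1 h2

/-- The same with the `NegSize` element on the left (`f : NegSize …` read through `NegSup.equiv`). [cite: Balaban1985Variational, p.286] -/
theorem norm_negSize_eq_msup {L : ℕ} {η : ℝ} [Fact (0 < ((L : ℕ) : ℝ))] [Fact (0 < η)]
    {k : ℕ} {lev : ι → ℕ} (hlev : ∀ x, lev x ≤ k) (n : ℕ) (F : NegSize (L : ℝ) η lev n E) :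
    ‖F‖ = msup L k η (-(n : ℝ)) (fun j x => lev x = j) (NegSup.equiv (levWeight (L : ℝ) η lev n) E F) := by
  rw [msup_levelEq_eq_norm_negSize hlev n]
  rfl

end Core

/-! ## §2 The jet norm (115) and the SHAPE of `norm_G` versus (3.47) at `γ = −3` -/

section Jet

variable {ι κ : Type*} [Fintype ι] [Fintype κ] {𝕜 : Type*} [NontriviallyNormedField 𝕜] {V : Type*} [NormedAddCommGroup V] [NormedSpace 𝕜 V]

/-- **`‖A‖_{(115)} = max{|A|_{(−1)}, |∇A|_{(−2)}}` IN `msup` LETTERS** (level maps `lev₀ ≤ k` on the points of `A`, `lev₁ ≤ k` on the points of `∇A`).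
[cite: Balaban1985Variational, (115) p.294; Balaban1985BackgroundPropagators, (3.39)–(3.41) p.397] -/
theorem norm_space115_eq_max_msup {L : ℕ} {η : ℝ} [Fact (0 < ((L : ℕ) : ℝ))] [Fact (0 < η)] {k : ℕ}
    {lev₀ : ι → ℕ} {lev₁ : κ → ℕ} (h₀ : ∀ x, lev₀ x ≤ k) (h₁ : ∀ y, lev₁ y ≤ k) (D : (ι → V) →ₗ[𝕜] (κ → V))
    (A : Space115 (L : ℝ) η lev₀ lev₁ D) :
    ‖A‖ = max (msup L k η (-(1 : ℝ)) (fun j x => lev₀ x = j) (JetSup.equiv _ _ D A))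
      (msup L k η (-(2 : ℝ)) (fun j y => lev₁ y = j) (D (JetSup.equiv _ _ D A))) := by
  rw [JetSup.norm_def]
  have e1 : ‖JetSup.fst A‖ = msup L k η (-(1 : ℝ)) (fun j x => lev₀ x = j) (JetSup.equiv _ _ D A) := by
    have := norm_negSize_eq_msup (E := V) h₀ 1 (JetSup.fst A)
    rw [Nat.cast_one] at this
    exact this
  have e2 : ‖JetSup.snd A‖ = msup L k η (-(2 : ℝ)) (fun j y => lev₁ y = j) (D (JetSup.equiv _ _ D A)) := by
    have := norm_negSize_eq_msup (E := V) h₁ 2 (JetSup.snd A)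
    rw [Nat.cast_ofNat] at this
    exact this
  rw [e1, e2]

/-- ★ **THE SHAPE DICTIONARY `norm_G` ↔ (3.47)₁ at `γ = −3`**: for ANY map `G` from the size `|·|_{(−3)}` to the space (115) and any `B₀`, the sentence
«`‖G λ‖_{(115)} ≤ B₀‖λ‖_{(−3)}` for every `λ`» (= `B11Prop6Concrete.SectEDatum.norm_G`'s text, (117) «by Theorem 3.13 of [5]») is EQUIVALENT to the pair of (3.47)-type
sentences «`|Gλ|_{(−1)} ≤ B₀|λ|_{(−3)}` and `|∇(Gλ)|_{(−2)} ≤ B₀|λ|_{(−3)}`» in `msup` letters (`|G′λ|_{(2+γ)}, |∇_U G′λ|_{(1+γ)} ≤ B₀|λ|_{(γ)}`, `γ = −3`).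
[cite: Balaban1985Variational, (117) p.295; Balaban1985BackgroundPropagators, (3.47) p.398, Thm 3.13 p.426] -/
theorem forall_norm_le_iff_msup_pair {L : ℕ} {η : ℝ} [Fact (0 < ((L : ℕ) : ℝ))] [Fact (0 < η)] {k : ℕ}
    {lev₀ : ι → ℕ} {lev₁ : κ → ℕ} (h₀ : ∀ x, lev₀ x ≤ k) (h₁ : ∀ y, lev₁ y ≤ k) (D : (ι → V) →ₗ[𝕜] (κ → V))
    (G : NegSize (L : ℝ) η lev₀ 3 V → Space115 (L : ℝ) η lev₀ lev₁ D) (B₀ : ℝ) :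
    (∀ lam, ‖G lam‖ ≤ B₀ * ‖lam‖) ↔
      ∀ lam, msup L k η (-(1 : ℝ)) (fun j x => lev₀ x = j) (JetSup.equiv _ _ D (G lam)) ≤
            B₀ * msup L k η (-(3 : ℝ)) (fun j x => lev₀ x = j) (NegSup.equiv (levWeight (L : ℝ) η lev₀ 3) V lam) ∧
          msup L k η (-(2 : ℝ)) (fun j y => lev₁ y = j) (D (JetSup.equiv _ _ D (G lam))) ≤
            B₀ * msup L k η (-(3 : ℝ)) (fun j x => lev₀ x = j) (NegSup.equiv (levWeight (L : ℝ) η lev₀ 3) V lam) := by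
  have e3 : ∀ lam : NegSize (L : ℝ) η lev₀ 3 V,
      ‖lam‖ = msup L k η (-(3 : ℝ)) (fun j x => lev₀ x = j) (NegSup.equiv (levWeight (L : ℝ) η lev₀ 3) V lam) := fun lam => by
    have := norm_negSize_eq_msup (E := V) h₀ 3 lam
    rw [Nat.cast_ofNat] at this
    exact this
  refine forall_congr' fun lam => ?_
  rw [norm_space115_eq_max_msup h₀ h₁ D (G lam), e3 lam, max_le_iff]

end Jet

/-! ## §3 On the V1 k-level torus index: `geo9K`'s `wNorm` at `γ = −n` IS a (115)-size -/

section V1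

variable {d ℓ : ℕ} {hd : 1 ≤ d + 1} {hL : Odd (ℓ + 1) ∧ 1 < ℓ + 1} {b₀ b₁ : ℝ}

/-- `wNormB` of the norm profile of an `E`-valued fine-bond function is its `E`-valued weighted sup. [cite: Balaban1985BackgroundPropagators, (3.41) p.397] -/
theorem wNormB_norm_comp {E : Type*} [NormedAddCommGroup E] (i : KIdx d ℓ hd hL b₀ b₁) (γ : ℝ) (f : PBond (PV d ℓ i.m i.K hd hL) 0 → E) :
    wNormB i γ (fun x => ‖f x‖) =
      msup (ℓ + 1) i.k |i.cf|⁻¹ γ (fun j (x : PBond (PV d ℓ i.m i.K hd hL) 0) => (blkV1 i.hN i.D x).1.1 = j) f := by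
  unfold wNormB
  exact msup_norm_comp _ _ _ _ _ f

/-- ★ **`wNormB i (−n) J = ‖J‖_{NegSize (ℓ+1) |c_f|⁻¹ (level of the bond's block) n}`** — the fine-bond summand of `geo9K i`'s `wNorm` at `γ = −n` IS the (115)-size with
`L := ℓ + 1`, `η := |c_f|⁻¹`, `lev x :=` the level of the block of `x` (`blkV1_level_le`). [cite: Balaban1985BackgroundPropagators, (3.41) p.397; Balaban1985Variational, p.286] -/
theorem wNormB_neg_natCast_eq_norm_negSize (i : KIdx d ℓ hd hL b₀ b₁) [Fact (0 < (((ℓ + 1 : ℕ) : ℕ) : ℝ))] [Fact (0 < |i.cf|⁻¹)]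
    (n : ℕ) (J : PBond (PV d ℓ i.m i.K hd hL) 0 → ℝ) :
    wNormB i (-(n : ℝ)) J =
      ‖(NegSup.equiv (levWeight (((ℓ + 1 : ℕ) : ℕ) : ℝ) |i.cf|⁻¹ (fun x : PBond (PV d ℓ i.m i.K hd hL) 0 => (blkV1 i.hN i.D x).1.1) n) ℝ).symm J‖ := by
  unfold wNormB
  exact msup_levelEq_eq_norm_negSize (blkV1_level_le i) n J

/-- The same for the torus-SITE summand `wNormS` (levels of the blocks of sites, `blkOf_level_le`). [cite: Balaban1985BackgroundPropagators, (3.41) p.397] -/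
theorem wNormS_neg_natCast_eq_norm_negSize (i : KIdx d ℓ hd hL b₀ b₁) [Fact (0 < (((ℓ + 1 : ℕ) : ℕ) : ℝ))] [Fact (0 < |i.cf|⁻¹)]
    (n : ℕ) (f : ↥(toKT i).XB → ℝ) :
    wNormS i (-(n : ℝ)) f =
      ‖(NegSup.equiv (levWeight (((ℓ + 1 : ℕ) : ℕ) : ℝ) |i.cf|⁻¹ (fun x : ↥(toKT i).XB => (blkOf i.D.toDomains x).1.1) n) ℝ).symm f‖ := by
  unfold wNormS
  exact msup_levelEq_eq_norm_negSize (blkOf_level_le i) n f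

/-- `E`-valued form: for a fine-bond function `f` with values in a normed group, `wNormB i (−n) (‖f ·‖) = ‖f‖_{NegSize … n}`. [cite: Balaban1985BackgroundPropagators, (3.41) p.397] -/
theorem wNormB_norm_comp_eq_norm_negSize {E : Type*} [NormedAddCommGroup E] (i : KIdx d ℓ hd hL b₀ b₁)
    [Fact (0 < (((ℓ + 1 : ℕ) : ℕ) : ℝ))] [Fact (0 < |i.cf|⁻¹)] (n : ℕ) (f : PBond (PV d ℓ i.m i.K hd hL) 0 → E) :
    wNormB i (-(n : ℝ)) (fun x => ‖f x‖) =
      ‖(NegSup.equiv (levWeight (((ℓ + 1 : ℕ) : ℕ) : ℝ) |i.cf|⁻¹ (fun x : PBond (PV d ℓ i.m i.K hd hL) 0 => (blkV1 i.hN i.D x).1.1) n) E).symm f‖ := by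
  rw [wNormB_norm_comp]
  exact msup_levelEq_eq_norm_negSize (blkV1_level_le i) n f

end V1

/-! ## §4 The pure-small-field diagonal: one level `lev ≡ k`, `Lᵏη = 1` — every weight is `1` and the (115)-sizes are the sup norms -/

section Diagonal

variable {ι : Type*} [Fintype ι] {E : Type*} [NormedAddCommGroup E]

omit [Fintype ι] in
/-- On the diagonal (`lev ≡ k`, `Lᵏ·η = 1`) every (115)-weight is `1`. [cite: Balaban1985Variational, p.286; Balaban1985RegularSpaces, p.77 (Ω_j = T_η)] -/
theorem levWeight_eq_one_of_diag {L η : ℝ} {k : ℕ} {lev : ι → ℕ} (hlev : ∀ x, lev x = k) (hdiag : L ^ k * η = 1) (n : ℕ) (x : ι) :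
    levWeight L η lev n x = 1 := by
  rw [levWeight_apply, hlev x, hdiag, one_pow]

/-- ★ **ON THE DIAGONAL THE SIZE `|·|_{(−n)}` IS THE SUP NORM**: `‖f‖_{NegSize L η (fun _ ↦ k) n} = ‖f‖_∞` when `Lᵏη = 1` (★w5-20520's transport item (t3); constants `1` both ways).
[cite: Balaban1985Variational, p.286] -/
theorem norm_negSize_eq_norm_of_diag {L η : ℝ} [Fact (0 < L)] [Fact (0 < η)] {k : ℕ} {lev : ι → ℕ}
    (hlev : ∀ x, lev x = k) (hdiag : L ^ k * η = 1) (n : ℕ) (f : ι → E) :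
    ‖(NegSup.equiv (levWeight L η lev n) E).symm f‖ = ‖f‖ := by
  have hw : ∀ x, levWeight L η lev n x = 1 := levWeight_eq_one_of_diag hlev hdiag n
  refine le_antisymm ?_ ?_
  · refine NegSup.norm_symm_le_of_pointwise (norm_nonneg f) fun x => ?_
    rw [hw x, one_mul]
    exact norm_le_pi_norm f x
  · refine (pi_norm_le_iff_of_nonneg (norm_nonneg _)).2 fun x => ?_
    have h := NegSup.weight_mul_norm_apply_le ((NegSup.equiv (levWeight L η lev n) E).symm f) x
    rw [hw x, one_mul] at h
    simpa using h

/-- … hence so is `msup` at `α = −n` with the one-level membership (`L : ℕ`, `Lᵏη = 1`). [cite: Balaban1985BackgroundPropagators, (3.41) p.397] -/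
theorem msup_eq_norm_of_diag {L : ℕ} {η : ℝ} [Fact (0 < ((L : ℕ) : ℝ))] [Fact (0 < η)] {k : ℕ}
    (hdiag : (L : ℝ) ^ k * η = 1) (n : ℕ) (f : ι → E) :
    msup L k η (-(n : ℝ)) (fun j (_ : ι) => k = j) f = ‖f‖ := by
  rw [msup_levelEq_eq_norm_negSize (lev := fun _ => k) (fun _ => le_rfl) n f]
  exact norm_negSize_eq_norm_of_diag (fun _ => rfl) hdiag n f

end Diagonal

end Summit.QuantumFields.YangMills.Theorems.Prop7SectE115WNormDict

end
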